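import Summits.Ventures.CertifiedManyBodySolver.Theorems.CovHg1201M19P10KinematicPartsTp
import HarnessLib

/-!
# Theorems/CovHg1201M19P10BottomSlackLadder.lean — route «CovHg1201M19P10» (Hg-1201 @ 10 GPa), crux «PatchBottomP10» (stmt-Ventures-27105):
# the SLACK-SCHEDULE adapter (captain RULING «TP-KINCUT» 2026-08-28T10:37:56Z (4); hubbard-cov-hg1201-ref-1 structural note 10:37:23Z)

Supports stmt-Ventures-27105. In the uniform corner-objective form (`Theorems/CovHg1201M19P10StripAdapters.lean`, `…KinematicPartsTp.lean`) every source `s` of a bottom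
cell must certify the CORNER objective `−X₀(−49/100, 3)` below the bar `0.4767609`. But the target-slot word at `σ` is the `σ`-CHORD
`a(σ)·(corner value) + b(σ)·(inner END value)`, `a(σ) = (−47/100 − σ)·50`, `b(σ) = (σ + 49/100)·50`, and the inner END value is KINEMATIC (`≤ 0.4763357` at every
`n ≤ 22/25`, `hg1201P10_kinematicReading_le_bar`); a source `s` only serves targets `σ ≥ s`. Hence a cell `[s₁, s₂]` of sources needs only the SLACK price
`a(s₁)·(−r) + b(s₁)·0.4763357 ≤ 0.4767609` — equal to `−r ≤ bar` at the corner `s₁ = −49/100` and looser inward (tolerance `→ ∞` as `s₁ → −47/100`; at `s₁ = −12/25`: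
`−r ≤ 0.4771861`). This file types that schedule:
* §1 `covHg1201P10_slotWord_of_cornerValue_slack` — one corner value `v` at a source, slack price at a slot `σ₀ ≤ σ` ⇒ the target-slot word at `σ`;
* §2 `covHg1201M19P10_bottomCell_of_boxRowW_slack` — ONE windowed cell `![3, s₁, n₁] … ![3, s₂, n₂]` (`−49/100 ≤ s₁`, `s₂ ≤ −47/100`, kinematic floor discharged, cap by
  `hcap`) with the slack price AT ITS OUTER EDGE `s₁` ⇒ the bottom bundle for all targets `σ ∈ [−49/100, −47/100]` and sources `s ∈ [s₁, s₂]`, `s ≤ σ`;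
* §3 `covHg1201M19P10_PatchBottomP10_of_bottomCellsW_slackLadder` — «PatchBottomP10» from a `t′`-LADDER of windowed cells `[P k, P (k+1)]` covering the TP-KINCUT
  sub-span `[−49/100, −12/25]` on the density strip `[43/50, 22/25]`, cell `k` priced at `P k` (densities `n ≤ 43/50` and slots `σ ≥ −12/25` state-free).
HONEST FRAMING: bookkeeping + one-body kinematics; zero solve, no claim node, no definition; §2–§3 CONDITIONAL on cell rows no certificate supplies yet; certified
stiffness-scale CEILINGS on a downfolded screening-grade box = CONTROL / CALIBRATION + labelled heuristic (xx1; content = below 0.98 × the kinematic MAJORANT `0.4864908`,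
no suppression below free claimed; pressure only through the downfolded `(U/t, t′/t)` frame — no `dT_c/dP` sentence); a ceiling never speaks to the presence of
superconductivity; not a `T_c` or phase sentence; NO item or stub is closed by this file. Seat hubbard-cov-hg1201-box-2 g1 (`prover-hubbard-cov-hg1201-box-2-g0-0`).
-/

noncomputable section

namespace Summit.Ventures.CertifiedManyBodySolver.Theorems

open Set Filter Topology
open Summit.Ventures.CertifiedManyBodySolver.Theses.CovHg1201M19P10
open Summit.Ventures.CertifiedManyBodySolver.Observables
open Summit.Ventures.CertifiedManyBodySolver.Downfold
open Summit.Ventures.CertifiedManyBodySolver.Certificates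
open Summit.Ventures.CertifiedManyBodySolver
open Literature.MathematicalPhysics.QuantumLattice Literature.MathematicalPhysics.QuantumLattice.ThermodynamicLimit
open Literature.Probability.LatticeModels
open Matrix HubbardWave0
open scoped BigOperators ComplexOrder

/-! ## §1 The target-slot word from ONE corner value under the SLACK price -/

/-- **Slack-schedule chord.** For a slot `σ ∈ [σ₀, −47/100]` with `−49/100 ≤ σ₀`, a density `0 ≤ n ≤ 22/25`, a torus limit `ω` of unit sector ground states of
`hubbardTorusTT' L 1 s U_A'` at density `n`, a value `v ≤` the orbit mean of `−X₀(−49/100, U_A)`, and the SLACK PRICE at `σ₀`: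
`(−47/100 − σ₀)·50·(−v) + (σ₀ + 49/100)·50·0.4763357 ≤ 0.4767609` — the orbit mean of `−X₀(σ, U_A)` is `≥ −0.4767609`. (The price at `σ ≥ σ₀` is implied: if
`−v ≤ 0.4763357` the chord is a convex combination of two sub-bar numbers, otherwise the price decreases in `σ`.)
[cite: KomaTasaki1994, §1] [cite: LiebLoss1993, §8, Theorem 8.2] [cite: HazraVermaRanderia2019, eq. (4)] -/
theorem covHg1201P10_slotWord_of_cornerValue_slack (σ σ₀ UA s UA' : ℝ) (hσ₀ : -49 / 100 ≤ σ₀) (hσ : σ ∈ Icc σ₀ (-47 / 100))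
    {n : ℝ} (hn0 : 0 ≤ n) (hn : n ≤ 22 / 25) {v : ℝ}
    (hprice : (-47 / 100 - σ₀) * 50 * (-v) + (σ₀ - -49 / 100) * 50 * (4763357 / 10000000 : ℝ) ≤ (4767609 / 10000000 : ℝ))
    (ω : InfVolFermionState 2) (Ls : ℕ → ℕ) (ψ : ∀ L, Fock (Orb (FermionTorus 2 L)))
    (hLs : Tendsto Ls atTop atTop)
    (hψ : ∀ j, IsGroundStateInSector (hubbardTorusTT' (Ls j) 1 s UA') (rectN n (Ls j)) 0 (ψ (Ls j)))
    (h1 : ∀ j, star (ψ (Ls j)) ⬝ᵥ ψ (Ls j) = 1) (hω : ω.IsTorusLimitOf ψ Ls)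
    (hP : v ≤ ((Finset.univ : Finset (DihedralGroup 4)).card : ℝ)⁻¹ * ∑ g ∈ (Finset.univ : Finset (DihedralGroup 4)),
      (ω.expect (d4ShiftSet g 0 (box 2 7)) (fermionEmbed (PolySite.d4Emb g 0 (box 2 7)) (-oddMomentObsTT (-49 / 100) UA 0))).re) :
    -(4767609 / 10000000 : ℝ) ≤ ((Finset.univ : Finset (DihedralGroup 4)).card : ℝ)⁻¹ * ∑ g ∈ (Finset.univ : Finset (DihedralGroup 4)),
      (ω.expect (d4ShiftSet g 0 (box 2 7)) (fermionEmbed (PolySite.d4Emb g 0 (box 2 7)) (-oddMomentObsTT σ UA 0))).re := by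
  have hn2 : n < 2 := by linarith
  have hσI : σ ∈ Icc (-49 / 100 : ℝ) (-47 / 100) := ⟨hσ₀.trans hσ.1, hσ.2⟩
  have hchord := orbitLower_slot_chord_of_two_endObjectives hω.isTranslationInvariant UA (by norm_num : (-49 / 100 : ℝ) < -47 / 100) hσI hP
    (orbitMean_neg_oddMomentTT_lam_zero_ge_kinematic_of_gs (-47 / 100) UA s UA' halfBathtub_m47o100_P10chordLevel_le hn0 hn2 ω Ls ψ hLs hψ h1 hω)
  -- the kinematic inner-END value `Q n ≤ 0.4763357`
  set Q := (30977 / 57344 : ℝ) * n / 2 + ((6 / 7 : ℝ) * 0.2581118058 + 1 / 7 * 0.1218750438) with hQ_def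
  have hQ : Q ≤ 4763357 / 10000000 := by
    rw [hQ_def]; norm_num at hn ⊢; linarith
  -- chord weights at σ and at σ₀
  obtain ⟨ha, hb, hab⟩ := covHg1201P10_patch_slotWeights hσI
  set a := (-47 / 100 - σ) / (-47 / 100 - -49 / 100) with ha_def
  set b := (σ - -49 / 100) / (-47 / 100 - -49 / 100) with hb_def
  have ha₀ : a ≤ (-47 / 100 - σ₀) * 50 := by
    rw [ha_def, div_eq_mul_inv]; norm_num; linarith [hσ.1]
  have hb₀ : (σ₀ - -49 / 100) * 50 ≤ b := by
    rw [hb_def, div_eq_mul_inv]; norm_num; linarith [hσ.1]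
  have hab₀ : (-47 / 100 - σ₀) * 50 + (σ₀ - -49 / 100) * 50 = (1 : ℝ) := by ring
  -- the price at σ is below the bar
  have hpriceσ : a * (-v) + b * (4763357 / 10000000 : ℝ) ≤ 4767609 / 10000000 := by
    rcases le_or_gt (-v) (4763357 / 10000000 : ℝ) with hv | hv
    · calc a * (-v) + b * (4763357 / 10000000 : ℝ) ≤ a * (4763357 / 10000000) + b * (4763357 / 10000000) :=
            add_le_add (mul_le_mul_of_nonneg_left hv ha) le_rfl
        _ = 4763357 / 10000000 := by rw [← add_mul, hab, one_mul]
        _ ≤ 4767609 / 10000000 := by norm_num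
    · -- `−v` above the inner value: the price decreases in `σ`, so the price at `σ₀` dominates
      have hb' : b = 1 - a := by linarith [hab]
      have hb₀' : (σ₀ - -49 / 100) * 50 = 1 - (-47 / 100 - σ₀) * 50 := by linarith [hab₀]
      rw [hb']
      rw [hb₀'] at hprice
      nlinarith [ha₀, hv, hprice]
  have hQb : b * (-Q) ≥ b * (-(4763357 / 10000000 : ℝ)) := by
    have := mul_le_mul_of_nonneg_left hQ hb
    linarith
  have : a * v + b * (-Q) ≥ -(4767609 / 10000000 : ℝ) := by nlinarith [hpriceσ, hQb]
  linarith [hchord, this]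

/-! ## §2 The bottom bundle from ONE windowed cell priced at its OUTER edge -/

/-- **Bottom bundle from ONE WINDOWED cell `![3, s₁, n₁] … ![3, s₂, n₂]` under the slack schedule** (`−49/100 ≤ s₁`, `s₂ ≤ −47/100`, `0 ≤ n₁`, `n₂ ≤ 22/25`; floor row =
the a-priori kinematic constant, discharged; cap row `cap` by `hcap`; SLACK PRICE at the outer edge `s₁`): for every `n ∈ [n₁, n₂]`, every target `σ ∈ [s₁, −47/100]` and
every source `s ∈ [s₁, s₂]` with `s ≤ σ`, the «PatchBottomP10» body. [cite: KomaTasaki1994, §1] [cite: ScalapinoWhiteZhang1993, §II] [cite: WangEtAl2024, §III] -/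
theorem covHg1201M19P10_bottomCell_of_boxRowW_slack {n₁ n₂ s₁ s₂ : ℝ} (hn₁ : 0 ≤ n₁) (hn₂ : n₂ ≤ 22 / 25)
    (hs₁ : -49 / 100 ≤ s₁) (hs₂ : s₂ ≤ -47 / 100) {cap : (Fin 3 → ℝ) → ℝ} {r : ℚ} (Uo : ℝ)
    (hrow : SquareTTPrimeCorrOrbitLowerBoxRowW ![3, s₁, n₁] ![3, s₂, n₂]
      (fun _ : Fin 3 → ℝ => (((-124827703/50000000 : ℚ)) : ℝ)) cap r Finset.univ (box 2 7) (-oddMomentObsTT (-49 / 100) Uo 0))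
    (hcap : ∀ θ ∈ Set.Icc (![3, s₁, n₁] : Fin 3 → ℝ) ![3, s₂, n₂], energyDensityTT' 1 (θ 1) (θ 0) (θ 2) ≤ cap θ)
    (hprice : (-47 / 100 - s₁) * 50 * (-((r : ℚ) : ℝ)) + (s₁ - -49 / 100) * 50 * (4763357 / 10000000 : ℝ) ≤ (4767609 / 10000000 : ℝ)) :
    ∀ n ∈ Set.Icc n₁ n₂, ∀ σ ∈ Set.Icc s₁ (-47 / 100), ∀ s ∈ Set.Icc s₁ s₂, s ≤ σ →
      ∀ (ω : InfVolFermionState 2) (Ls : ℕ → ℕ) (ψ : ∀ L, Fock (Orb (FermionTorus 2 L))),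
      Tendsto Ls atTop atTop →
      (∀ j, IsGroundStateInSector (hubbardTorusTT' (Ls j) 1 s 3) (rectN n (Ls j)) 0 (ψ (Ls j))) →
      (∀ j, star (ψ (Ls j)) ⬝ᵥ ψ (Ls j) = 1) → ω.IsTorusLimitOf ψ Ls →
      -(4767609 / 10000000 : ℝ) ≤ ((Finset.univ : Finset (DihedralGroup 4)).card : ℝ)⁻¹ * ∑ g ∈ (Finset.univ : Finset (DihedralGroup 4)),
        (ω.expect (d4ShiftSet g 0 (box 2 7)) (fermionEmbed (PolySite.d4Emb g 0 (box 2 7)) (-oddMomentObsTT σ 3 0))).re := by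
  intro n hn σ hσ s hs hsσ ω Ls ψ hLs hψ h1 hω
  have hθ : (![3, s, n] : Fin 3 → ℝ) ∈ Set.Icc (![3, s₁, n₁] : Fin 3 → ℝ) ![3, s₂, n₂] :=
    covHg1201P10_vec3_mem_Icc ⟨⟨le_rfl, le_rfl⟩, hs, hn⟩
  have hflo := covHg1201P10_cell_kinFloor (U₁ := 3) (U₂ := 3) (s₁ := s₁) (s₂ := s₂) (n₁ := n₁) (n₂ := n₂)
    (by norm_num) (by linarith) (by linarith) hn₁ (by linarith) _ hθ
  have hP : ((r : ℚ) : ℝ) ≤ ((Finset.univ : Finset (DihedralGroup 4)).card : ℝ)⁻¹ * ∑ g ∈ (Finset.univ : Finset (DihedralGroup 4)),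
      (ω.expect (d4ShiftSet g 0 (box 2 7)) (fermionEmbed (PolySite.d4Emb g 0 (box 2 7)) (-oddMomentObsTT (-49 / 100) 3 0))).re := by
    rw [oddMomentObsTT_lam_zero (-49 / 100) 3, ← oddMomentObsTT_lam_zero (-49 / 100) Uo]
    exact hrow _ hθ ω Ls ψ hLs hψ h1 hω hflo (hcap _ hθ)
  exact covHg1201P10_slotWord_of_cornerValue_slack σ s₁ 3 s 3 hs₁ hσ (hn₁.trans hn.1) (hn.2.trans hn₂) hprice ω Ls ψ hLs hψ h1 hω hP

/-! ## §3 «PatchBottomP10» from a t′-LADDER of windowed cells under the slack schedule -/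

/-- Locating a point of `[P 0, P m]` in a segment `[P k, P (k+1)]`, `k < m`. [folklore] -/
private theorem exists_ladder_segment_slack (P : ℕ → ℝ) :
    ∀ m : ℕ, 0 < m → ∀ x : ℝ, P 0 ≤ x → x ≤ P m → ∃ k < m, P k ≤ x ∧ x ≤ P (k + 1)
  | 0, hm, _, _, _ => (Nat.lt_irrefl 0 hm).elim
  | (m + 1), _, x, h0, hm1 => by
      by_cases hle : x ≤ P m
      · rcases Nat.eq_zero_or_pos m with hm0 | hmpos
        · subst hm0
          exact ⟨0, Nat.zero_lt_succ 0, h0, hm1⟩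
        · obtain ⟨k, hk, h1, h2⟩ := exists_ladder_segment_slack P m hmpos x h0 hle
          exact ⟨k, Nat.lt_succ_of_lt hk, h1, h2⟩
      · exact ⟨m, Nat.lt_succ_self m, le_of_lt (not_le.mp hle), hm1⟩

/-- **«PatchBottomP10» (stmt-Ventures-27105) from a t′-LADDER of windowed bottom cells under the SLACK SCHEDULE.** Breakpoints `P 0 = −49/100, …, P m = −12/25` (all in
`[−49/100, −12/25]`); for each `k < m` ONE windowed cell `![3, P k, 43/50] … ![3, P (k+1), 22/25]` (kinematic floor row discharged, cap row `cap k` by `hcap k`) with the slack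
price AT `P k`: `(−47/100 − P k)·50·(−r k) + (P k + 49/100)·50·0.4763357 ≤ 0.4767609` (= `−r 0 ≤ bar` for the corner cell, looser inward). Densities `n ≤ 43/50` and slots
`σ ≥ −12/25` are state-free (box-2 g0 / TP-KINCUT). CONDITIONAL on the rows. [cite: ScalapinoWhiteZhang1993, §II] [cite: KomaTasaki1994, §1] [cite: BoydVandenberghe2004, §5.9] -/
theorem covHg1201M19P10_PatchBottomP10_of_bottomCellsW_slackLadder (P : ℕ → ℝ) {m : ℕ} (hP0 : P 0 = -49 / 100) (hPm : P m = -12 / 25)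
    (hPlo : ∀ k ≤ m, -49 / 100 ≤ P k) (hPhi : ∀ k ≤ m, P k ≤ -12 / 25) (cap : ℕ → (Fin 3 → ℝ) → ℝ) (r : ℕ → ℚ) (Uo : ℝ)
    (hrow : ∀ k < m, SquareTTPrimeCorrOrbitLowerBoxRowW ![3, P k, 43 / 50] ![3, P (k + 1), 22 / 25]
      (fun _ : Fin 3 → ℝ => (((-124827703/50000000 : ℚ)) : ℝ)) (cap k) (r k) Finset.univ (box 2 7) (-oddMomentObsTT (-49 / 100) Uo 0))
    (hcap : ∀ k < m, ∀ θ ∈ Set.Icc (![3, P k, 43 / 50] : Fin 3 → ℝ) ![3, P (k + 1), 22 / 25], energyDensityTT' 1 (θ 1) (θ 0) (θ 2) ≤ cap k θ)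
    (hprice : ∀ k < m, (-47 / 100 - P k) * 50 * (-((r k : ℚ) : ℝ)) + (P k - -49 / 100) * 50 * (4763357 / 10000000 : ℝ) ≤ (4767609 / 10000000 : ℝ)) :
    PatchBottomP10 := by
  have hm : 0 < m := by
    rcases Nat.eq_zero_or_pos m with h | h
    · exfalso; subst h; rw [hP0] at hPm; norm_num at hPm
    · exact h
  refine covHg1201M19P10_PatchBottomP10_of_outerStrip (fun n hn σ hσ s hs ω Ls ψ hLs hψ h1 hω => ?_)
  obtain ⟨k, hk, hPk, hPk1⟩ := exists_ladder_segment_slack P m hm s (by rw [hP0]; exact hs.1) (by rw [hPm]; exact hs.2.trans hσ.2)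
  have hPk_lo : -49 / 100 ≤ P k := hPlo k hk.le
  exact covHg1201M19P10_bottomCell_of_boxRowW_slack (by norm_num) le_rfl hPk_lo ((hPhi (k + 1) hk).trans (by norm_num)) Uo (hrow k hk) (hcap k hk)
    (hprice k hk) n hn σ ⟨hPk.trans hs.2, hσ.2.trans (by norm_num)⟩ s ⟨hPk, hPk1⟩ hs.2 ω Ls ψ hLs hψ h1 hω
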